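import Mathlib
import HarnessLib
import Summits.NavierStokesRegularity.NavierStokesRegularity.Theorems.QuarterLogPincerHelmholtzCentreShellTools
import Literature.Analysis.FluidPDE.LocalBiotSavartHelmholtz
import Literature.Analysis.FluidPDE.EnergyUniqueness
import Literature.Analysis.FluidPDE.VorticityCalculus

/-!
# Route `QuarterLogPincer`, crux `TypeIQuantSubcubicExp` (stmt-NavierStokesRegularity-24077), line `vortical_centre` —
# H2♭ `stub_shellKernelBound : ShellKernelBound` BY NAME (Green representation + one integration by parts on the shell)

ns-idea-7's line `vortical_centre` (v1.2, idea-crit-4 PASS) has ONE open stub, H2♭ `HelmholtzCentre.ShellKernelBound`: for `v ∈ C²(ℝ³;ℝ³)`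
divergence free, `R > 0`, with `χ = ballCutoff y (R/3)`, `‖v(y) − K∗(χ curl v)(y)‖ ≤ C (R⁻³∫_{B(y,R)}‖v‖ + R⁻²∫_{B(y,R)}‖curl v‖)`.  Proof = the card's
route (typed plan `typer/STUB-PLAN-ShellKernelBound.md`, parts T3/T4): the tree's Green representation
`smul_eq_biotSavart_add_integral_newtonKernel` gives `v(y) − K∗(χω)(y) = ∫Γ(y−z)•G(z)` with
`G = ∇χ×ω + 2Σᵢ∂ᵢχ∂ᵢv + (Δχ)v` (`laplacian_smul_add_curl_smul_curl_eq`, `div v = 0`); ONE integration by parts against the `W^{1,1}` kernel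
(`integral_newtonKernel_smul_fderiv_eq` with `Φᵢ = (∂ᵢχ)•v`) turns the middle term into `2Σᵢ∫(∂ᵢΓ)(y−z)Φᵢ(z) − 2∫Γ(Δχ)v`; all integrands live on
the shell `2R/3 ≤ ‖z−y‖ ≤ R` (a.e.: the sphere is null), where `‖Γ‖ ≤ 3/(8πR)`, `‖DΓ‖ ≤ 9/(16πR²)`, `‖Dχ‖ ≤ 3C₀/R`, `|Δχ| ≤ 9C₂/R²`
(`…HelmholtzCentreShellTools`, `exists_norm_fderiv_ballCutoff_le`).

HONEST FRAME: linear potential theory for `C²` divergence-free fields; it closes the line's last stub, hence Sb `SilencingCost.VorticalCentre`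
(`vorticalCentre_of_shellKernelBound`); nothing here bears on Sc′/B2, 24077's truth, W7 or Navier–Stokes regularity (OPEN / not proved).
pub-ns-dss typer (g38), `--supports stmt-NavierStokesRegularity-24077`.
-/

noncomputable section

set_option linter.dupNamespace false

namespace Summit.NavierStokesRegularity.NavierStokesRegularity.Cruxes.TypeIQuantSubcubicExp.HelmholtzCentre

open MeasureTheory Set Function Filter Topology Metric
open scoped ENNReal NNReal Laplacian RealInnerProductSpace
open Literature.Analysis Literature.Analysis.FluidPDE

/-- The derivative of the ball cutoff vanishes on the CLOSED exterior `‖z − c‖ ≥ 3r` (a minimum of the nonnegative cutoff). -/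
theorem fderiv_ballCutoff_eq_zero_of_le_norm {c : EuclideanSpace ℝ (Fin 3)} {r : ℝ} (hr : 0 < r)
    {z : EuclideanSpace ℝ (Fin 3)} (hz : 3 * r ≤ ‖z - c‖) : fderiv ℝ (ballCutoff c r) z = 0 := by
  refine IsLocalMin.fderiv_eq_zero (Filter.Eventually.of_forall fun w => ?_)
  rw [ballCutoff_eq_zero hr hz]
  exact ballCutoff_nonneg c r w

/-- An integrand bound of shell type integrates to the ball integral: if `‖F z‖ ≤ K ‖f z‖` on `B(y,R)` and `F z = 0` for
`R < ‖z − y‖` (the sphere is null), then `‖∫F‖ ≤ K ∫_{B(y,R)} ‖f‖`. -/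
theorem norm_integral_le_of_shell {F : EuclideanSpace ℝ (Fin 3) → EuclideanSpace ℝ (Fin 3)}
    {f : EuclideanSpace ℝ (Fin 3) → EuclideanSpace ℝ (Fin 3)} (hf : Continuous f) {y : EuclideanSpace ℝ (Fin 3)} {R K : ℝ}
    (hin : ∀ z ∈ ball y R, ‖F z‖ ≤ K * ‖f z‖)
    (hout : ∀ z, R < ‖z - y‖ → F z = 0) :
    ‖∫ z, F z‖ ≤ K * ∫ z in ball y R, ‖f z‖ := by
  have hint : IntegrableOn (fun z => K * ‖f z‖) (ball y R) volume :=
    (((hf.norm.const_mul K).continuousOn).integrableOn_compact (isCompact_closedBall y R)).mono_set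
      ball_subset_closedBall
  have hg : Integrable ((ball y R).indicator fun z => K * ‖f z‖) volume :=
    (integrable_indicator_iff measurableSet_ball).2 hint
  have hae : ∀ᵐ z ∂(volume : Measure (EuclideanSpace ℝ (Fin 3))),
      ‖F z‖ ≤ (ball y R).indicator (fun z => K * ‖f z‖) z := by
    filter_upwards [measure_eq_zero_iff_ae_notMem.1 (Measure.addHaar_sphere volume y R)] with z hz
    by_cases hzb : z ∈ ball y R
    · rw [indicator_of_mem hzb]; exact hin z hzb
    · rw [indicator_of_notMem hzb]
      have hRz : R < ‖z - y‖ := by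
        rw [mem_ball_iff_norm, not_lt] at hzb
        rcases hzb.lt_or_eq with h | h
        · exact h
        · exact absurd (show z ∈ sphere y R by rw [mem_sphere_iff_norm]; exact h.symm) hz
      rw [hout z hRz, norm_zero]
  calc ‖∫ z, F z‖ ≤ ∫ z, (ball y R).indicator (fun z => K * ‖f z‖) z := norm_integral_le_of_norm_le hg hae
    _ = K * ∫ z in ball y R, ‖f z‖ := by rw [integral_indicator measurableSet_ball, integral_const_mul]

/-! ### T3 — the integration by parts of the middle term -/

/-- **One integration by parts against the Newtonian kernel**: for `v ∈ C²`, `χ ∈ C²_c` and a direction `a`,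
`∫ Γ(y−z) (∂ₐχ ∂ₐv)(z) dz = ∫ ∂ₐΓ(y−z) (∂ₐχ v)(z) dz − ∫ Γ(y−z) (∂ₐ∂ₐχ v)(z) dz`
(`integral_newtonKernel_smul_fderiv_eq` applied to `Φ = (∂ₐχ) v`, product rule). -/
theorem integral_newtonKernel_partial_smul_partial
    {v : EuclideanSpace ℝ (Fin 3) → EuclideanSpace ℝ (Fin 3)} (hv : ContDiff ℝ 2 v)
    {χ : EuclideanSpace ℝ (Fin 3) → ℝ} (hχ : ContDiff ℝ 2 χ) (hχc : HasCompactSupport χ) (y a : EuclideanSpace ℝ (Fin 3)) :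
    ∫ z, newtonKernel (y - z) • ((fderiv ℝ χ z a) • fderiv ℝ v z a) =
      (∫ z, (fderiv ℝ newtonKernel (y - z) a) • ((fderiv ℝ χ z a) • v z)) -
        ∫ z, newtonKernel (y - z) • ((fderiv ℝ (fderiv ℝ χ) z a a) • v z) := by
  have hv1 : ContDiff ℝ 1 v := hv.of_le one_le_two
  have hdχ1 : ContDiff ℝ 1 (fderiv ℝ χ) := hχ.fderiv_right (by norm_num)
  have hdχd : ∀ z, DifferentiableAt ℝ (fderiv ℝ χ) z := fun z => (hdχ1.differentiable one_ne_zero) z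
  have hvd : ∀ z, DifferentiableAt ℝ v z := fun z => (hv1.differentiable one_ne_zero) z
  have hΦ1 : ContDiff ℝ 1 (fun z => (fderiv ℝ χ z a) • v z) := (hdχ1.clm_apply contDiff_const).smul hv1
  have hΦc : HasCompactSupport (fun z => (fderiv ℝ χ z a) • v z) := (hχc.fderiv_apply (𝕜 := ℝ) a).smul_right
  -- product rule
  have hprod : ∀ z, fderiv ℝ (fun w => (fderiv ℝ χ w a) • v w) z a =
      (fderiv ℝ (fderiv ℝ χ) z a a) • v z + (fderiv ℝ χ z a) • fderiv ℝ v z a := by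
    intro z
    have hca : DifferentiableAt ℝ (fun w => fderiv ℝ χ w a) z := (hdχd z).clm_apply (differentiableAt_const _)
    have h1 : fderiv ℝ (fun w => fderiv ℝ χ w a) z a = fderiv ℝ (fderiv ℝ χ) z a a := by
      rw [fderiv_clm_apply (hdχd z) (differentiableAt_const _), fderiv_const_apply]
      simp
    rw [fderiv_fun_smul hca (hvd z)]
    change fderiv ℝ χ z a • fderiv ℝ v z a + (fderiv ℝ (fun w => fderiv ℝ χ w a) z a) • v z = _
    rw [h1, add_comm]
  -- compact supports (everything vanishes off `tsupport (fderiv χ)`)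
  have hK : IsCompact (tsupport (fderiv ℝ χ)) := (hχc.fderiv (𝕜 := ℝ)).isCompact
  have hzero : ∀ z ∉ tsupport (fderiv ℝ χ), fderiv ℝ χ z = 0 := fun z hz => image_eq_zero_of_notMem_tsupport hz
  have hzero2 : ∀ z ∉ tsupport (fderiv ℝ χ), fderiv ℝ (fderiv ℝ χ) z = 0 := fun z hz =>
    image_eq_zero_of_notMem_tsupport fun h => hz (tsupport_fderiv_subset ℝ h)
  have hE₂c : Continuous (fun z => (fderiv ℝ (fderiv ℝ χ) z a a) • v z) :=
    (((hdχ1.continuous_fderiv one_ne_zero).clm_apply continuous_const).clm_apply continuous_const).smul hv.continuous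
  have hE₂s : HasCompactSupport (fun z => (fderiv ℝ (fderiv ℝ χ) z a a) • v z) := by
    refine HasCompactSupport.intro hK fun z hz => ?_
    show (fderiv ℝ (fderiv ℝ χ) z a a) • v z = 0
    rw [hzero2 z hz]; simp
  have hBc : Continuous (fun z => (fderiv ℝ χ z a) • fderiv ℝ v z a) :=
    ((hχ.continuous_fderiv (by norm_num)).clm_apply continuous_const).smul
      ((hv1.continuous_fderiv one_ne_zero).clm_apply continuous_const)
  have hBs : HasCompactSupport (fun z => (fderiv ℝ χ z a) • fderiv ℝ v z a) := by
    refine HasCompactSupport.intro hK fun z hz => ?_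
    show (fderiv ℝ χ z a) • fderiv ℝ v z a = 0
    rw [hzero z hz]; simp
  have hIE₂ := integrable_newtonKernel_smul hE₂c hE₂s y
  have hIB := integrable_newtonKernel_smul hBc hBs y
  have h := integral_newtonKernel_smul_fderiv_eq hΦ1 hΦc y a
  have e1 : (fun z => newtonKernel (y - z) • fderiv ℝ (fun w => (fderiv ℝ χ w a) • v w) z a) =
      fun z => newtonKernel (y - z) • ((fderiv ℝ (fderiv ℝ χ) z a a) • v z) +
        newtonKernel (y - z) • ((fderiv ℝ χ z a) • fderiv ℝ v z a) := by
    funext z; rw [hprod z, smul_add]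
  rw [e1, integral_add hIE₂ hIB] at h
  rw [← h, add_sub_cancel_left]

/-- **The Green remainder in IBP form.**  For `v ∈ C²` divergence free, `χ = ballCutoff y (R/3)`, `eᵢ` the standard basis:
`v(y) − K∗(χ curl v)(y) = ∫Γ(y−z)•(∇χ×ω)(z) + 2Σᵢ∫(∂ᵢΓ)(y−z)•(∂ᵢχ v)(z) − ∫Γ(y−z)•((Δχ) v)(z)`. -/
theorem shell_representation {v : EuclideanSpace ℝ (Fin 3) → EuclideanSpace ℝ (Fin 3)} (hv : ContDiff ℝ 2 v)
    (hdiv : VectorCalculus.IsDivFree v) (y : EuclideanSpace ℝ (Fin 3)) {R : ℝ} (hR : 0 < R) :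
    v y - biotSavart (cutVorticity v y R) y =
      (∫ z, newtonKernel (y - z) • curlCLM ((fderiv ℝ (ballCutoff y (R / 3)) z).smulRight (curl v z))) +
        (2 : ℝ) • (∑ i, ∫ z, (fderiv ℝ newtonKernel (y - z) (stdOrthonormalBasis ℝ (EuclideanSpace ℝ (Fin 3)) i)) •
          ((fderiv ℝ (ballCutoff y (R / 3)) z (stdOrthonormalBasis ℝ (EuclideanSpace ℝ (Fin 3)) i)) • v z)) -
        ∫ z, newtonKernel (y - z) • (((Δ (ballCutoff y (R / 3))) z) • v z) := by
  set r : ℝ := R / 3 with hr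
  have hr0 : 0 < r := by positivity
  set χ : EuclideanSpace ℝ (Fin 3) → ℝ := ballCutoff y r with hχdef
  set e := stdOrthonormalBasis ℝ (EuclideanSpace ℝ (Fin 3)) with he
  have hχ : ContDiff ℝ 2 χ := contDiff_ballCutoff y r
  have hχc : HasCompactSupport χ := hasCompactSupport_ballCutoff hr0
  have hv1 : ContDiff ℝ 1 v := hv.of_le one_le_two
  have hω1 : ContDiff ℝ 1 (curl v) := contDiff_curl (n := 1) (by exact hv)
  have hdχ1 : ContDiff ℝ 1 (fderiv ℝ χ) := hχ.fderiv_right (by norm_num)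
  -- Step 1: Green representation at the centre
  have hrep := smul_eq_biotSavart_add_integral_newtonKernel hv hχ hχc y
  have hχy : χ y = 1 := ballCutoff_eq_one hr0 (by rw [sub_self, norm_zero]; positivity)
  have hcut : (fun z => χ z • curl v z) = cutVorticity v y R := by
    funext z
    rw [cutVorticity_apply]
  set G : EuclideanSpace ℝ (Fin 3) → EuclideanSpace ℝ (Fin 3) :=
    fun z => (Δ (fun w => χ w • v w)) z + curl (fun w => χ w • curl v w) z with hGdef
  rw [← hcut]
  have hdiff : v y - biotSavart (fun z => χ z • curl v z) y = ∫ z, newtonKernel (y - z) • G z := by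
    rw [hχy, one_smul] at hrep
    rw [hrep, add_sub_cancel_left]
  -- Step 2: the lower-order terms
  set B : EuclideanSpace ℝ (Fin 3) → EuclideanSpace ℝ (Fin 3) :=
    fun z => ∑ i, (fderiv ℝ χ z (e i)) • fderiv ℝ v z (e i) with hBdef
  set D : EuclideanSpace ℝ (Fin 3) → EuclideanSpace ℝ (Fin 3) := fun z => ((Δ χ) z) • v z with hDdef
  set A : EuclideanSpace ℝ (Fin 3) → EuclideanSpace ℝ (Fin 3) := fun z => G z - (2 : ℝ) • B z - D z with hAdef
  have hG : ∀ z, G z = curlCLM ((fderiv ℝ χ z).smulRight (curl v z)) + (2 : ℝ) • B z + D z := fun z =>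
    laplacian_smul_add_curl_smul_curl_eq hv hχ (Or.inr (Eventually.of_forall fun w => hdiv w))
  have hA : ∀ z, A z = curlCLM ((fderiv ℝ χ z).smulRight (curl v z)) := by
    intro z
    show G z - (2 : ℝ) • B z - D z = _
    rw [hG z]; abel
  -- continuity / compact support
  have hGc : Continuous G :=
    (contDiff_laplacian (n := 0) (by exact hχ.smul hv)).continuous.add
      (continuous_curl ((hχ.of_le one_le_two).smul hω1))
  have hGs : HasCompactSupport G := by
    refine HasCompactSupport.add ?_ (hasCompactSupport_curl (hχc.smul_right))
    exact HasCompactSupport.of_support_subset_isCompact (hχc.smul_right (f' := v)).isCompact fun z hz => by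
      by_contra h
      exact hz (laplacian_eq_zero_of_notMem_tsupport h)
  have hDχc : Continuous (fderiv ℝ χ) := hχ.continuous_fderiv (by norm_num)
  have hΔχc : Continuous (Δ χ) := (contDiff_laplacian (n := 0) (by exact hχ)).continuous
  have hDc : Continuous D := hΔχc.smul hv.continuous
  have hBic : ∀ i, Continuous (fun z => (fderiv ℝ χ z (e i)) • fderiv ℝ v z (e i)) := fun i =>
    (hDχc.clm_apply continuous_const).smul ((hv1.continuous_fderiv one_ne_zero).clm_apply continuous_const)
  have hBc : Continuous B := continuous_finsetSum _ fun i _ => hBic i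
  have hAc : Continuous A := by
    show Continuous fun z => G z - (2 : ℝ) • B z - D z
    exact (hGc.sub (hBc.const_smul (2 : ℝ))).sub hDc
  have hK : IsCompact (tsupport (fderiv ℝ χ)) := (hχc.fderiv (𝕜 := ℝ)).isCompact
  have hzero : ∀ z ∉ tsupport (fderiv ℝ χ), fderiv ℝ χ z = 0 := fun z hz => image_eq_zero_of_notMem_tsupport hz
  have hzero2 : ∀ z ∉ tsupport (fderiv ℝ χ), fderiv ℝ (fderiv ℝ χ) z = 0 := fun z hz =>
    image_eq_zero_of_notMem_tsupport fun h => hz (tsupport_fderiv_subset ℝ h)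
  have hDs : HasCompactSupport D := by
    refine HasCompactSupport.intro hK fun z hz => ?_
    show ((Δ χ) z) • v z = 0
    rw [laplacian_apply_eq_sum_fderiv_fderiv e χ z, hzero2 z hz]
    simp
  have hBis : ∀ i, HasCompactSupport (fun z => (fderiv ℝ χ z (e i)) • fderiv ℝ v z (e i)) := fun i => by
    refine HasCompactSupport.intro hK fun z hz => ?_
    show (fderiv ℝ χ z (e i)) • fderiv ℝ v z (e i) = 0
    rw [hzero z hz]; simp
  have hAs : HasCompactSupport A := by
    refine HasCompactSupport.intro hK fun z hz => ?_
    rw [hA z, hzero z hz]; simp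
  have hIA := integrable_newtonKernel_smul hAc hAs y
  have hID := integrable_newtonKernel_smul hDc hDs y
  have hIBi : ∀ i, Integrable fun z => newtonKernel (y - z) • ((fderiv ℝ χ z (e i)) • fderiv ℝ v z (e i)) :=
    fun i => integrable_newtonKernel_smul (hBic i) (hBis i) y
  have hIE₂ : ∀ i, Integrable fun z => newtonKernel (y - z) • ((fderiv ℝ (fderiv ℝ χ) z (e i) (e i)) • v z) := by
    intro i
    refine integrable_newtonKernel_smul ?_ ?_ y
    · exact (((hdχ1.continuous_fderiv one_ne_zero).clm_apply continuous_const).clm_apply continuous_const).smul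
        hv.continuous
    · refine HasCompactSupport.intro hK fun z hz => ?_
      show (fderiv ℝ (fderiv ℝ χ) z (e i) (e i)) • v z = 0
      rw [hzero2 z hz]; simp
  -- Step 3: split the integral and integrate the middle term by parts
  have eG : (fun z => newtonKernel (y - z) • G z) = fun z =>
      newtonKernel (y - z) • A z + (2 : ℝ) • (∑ i, newtonKernel (y - z) • ((fderiv ℝ χ z (e i)) • fderiv ℝ v z (e i))) +
        newtonKernel (y - z) • D z := by
    funext z
    have : G z = A z + (2 : ℝ) • B z + D z := by rw [hA z, hG z]
    rw [this, smul_add, smul_add, smul_comm (newtonKernel (y - z)) (2 : ℝ) (B z), hBdef]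
    simp only [Finset.smul_sum]
  have hIB : Integrable (fun z => ∑ i, newtonKernel (y - z) • ((fderiv ℝ χ z (e i)) • fderiv ℝ v z (e i))) :=
    integrable_finsetSum _ fun i _ => hIBi i
  have hIB2 : Integrable (fun z => (2 : ℝ) • ∑ i, newtonKernel (y - z) • ((fderiv ℝ χ z (e i)) • fderiv ℝ v z (e i))) := by
    exact hIB.smul (2 : ℝ)
  have hI1 : Integrable (fun z => newtonKernel (y - z) • A z +
      (2 : ℝ) • ∑ i, newtonKernel (y - z) • ((fderiv ℝ χ z (e i)) • fderiv ℝ v z (e i))) := by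
    exact hIA.add hIB2
  have hsumD : ∑ i, ∫ z, newtonKernel (y - z) • ((fderiv ℝ (fderiv ℝ χ) z (e i) (e i)) • v z) =
      ∫ z, newtonKernel (y - z) • D z := by
    rw [← integral_finsetSum _ fun i _ => hIE₂ i]
    congr 1
    funext z
    show ∑ i, newtonKernel (y - z) • ((fderiv ℝ (fderiv ℝ χ) z (e i) (e i)) • v z) = newtonKernel (y - z) • (((Δ χ) z) • v z)
    rw [← Finset.smul_sum, ← Finset.sum_smul, ← laplacian_apply_eq_sum_fderiv_fderiv e χ z]
  rw [hdiff, eG, integral_add hI1 hID, integral_add hIA hIB2, integral_smul, integral_finsetSum _ fun i _ => hIBi i]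
  simp_rw [integral_newtonKernel_partial_smul_partial hv hχ hχc y]
  rw [Finset.sum_sub_distrib, hsumD, smul_sub, two_smul ℝ (∫ z, newtonKernel (y - z) • D z)]
  simp_rw [hA]
  abel

/-! ### T4 — the three shell bounds and the assembly -/

/-- Shell bound (a): the `∇χ × ω` term, `‖∫Γ(y−z)•curlCLM((Dχ z).smulRight (curl v z))‖ ≤ (9‖curlCLM‖C₀/(8π)) R⁻² ∫_{B(y,R)}‖curl v‖`. -/
theorem shell_bound_cross {v : EuclideanSpace ℝ (Fin 3) → EuclideanSpace ℝ (Fin 3)} (hv : ContDiff ℝ 2 v)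
    {C₀ : ℝ} (hC₀0 : 0 ≤ C₀)
    (hC₀ : ∀ (c : EuclideanSpace ℝ (Fin 3)) (r : ℝ), 0 < r → ∀ z, ‖fderiv ℝ (ballCutoff c r) z‖ ≤ C₀ / r)
    (y : EuclideanSpace ℝ (Fin 3)) {R : ℝ} (hR : 0 < R) :
    ‖∫ z, newtonKernel (y - z) • curlCLM ((fderiv ℝ (ballCutoff y (R / 3)) z).smulRight (curl v z))‖ ≤
      (9 * ‖(curlCLM : ((EuclideanSpace ℝ (Fin 3)) →L[ℝ] (EuclideanSpace ℝ (Fin 3))) →L[ℝ] (EuclideanSpace ℝ (Fin 3)))‖ *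
        C₀ / (8 * Real.pi)) / R ^ 2 * ∫ z in ball y R, ‖curl v z‖ := by
  set κ : ℝ := ‖(curlCLM : ((EuclideanSpace ℝ (Fin 3)) →L[ℝ] (EuclideanSpace ℝ (Fin 3))) →L[ℝ]
    (EuclideanSpace ℝ (Fin 3)))‖ with hκ
  have hκ0 : 0 ≤ κ := by rw [hκ]; positivity
  have hr0 : 0 < R / 3 := by positivity
  have hω1 : ContDiff ℝ 1 (curl v) := contDiff_curl (n := 1) (by exact hv)
  have hDχ : ∀ z, ‖fderiv ℝ (ballCutoff y (R / 3)) z‖ ≤ 3 * C₀ / R := by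
    intro z
    calc ‖fderiv ℝ (ballCutoff y (R / 3)) z‖ ≤ C₀ / (R / 3) := hC₀ y (R / 3) hr0 z
      _ = 3 * C₀ / R := by field_simp
  refine norm_integral_le_of_shell hω1.continuous (fun z _ => ?_) (fun z hz => ?_)
  · by_cases hin : ‖z - y‖ < 2 * R / 3
    · have h0 : fderiv ℝ (ballCutoff y (R / 3)) z = 0 :=
        fderiv_ballCutoff_eq_zero_of_mem_ball hr0 (by rw [mem_ball_iff_norm]; linarith)
      rw [h0]; simp; positivity
    · rw [not_lt] at hin
      obtain ⟨hΓ, -⟩ := newtonKernel_shell_bounds hR hin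
      calc ‖newtonKernel (y - z) • curlCLM ((fderiv ℝ (ballCutoff y (R / 3)) z).smulRight (curl v z))‖
          = ‖newtonKernel (y - z)‖ * ‖curlCLM ((fderiv ℝ (ballCutoff y (R / 3)) z).smulRight (curl v z))‖ := norm_smul _ _
        _ ≤ (3 / (8 * Real.pi * R)) * (κ * ((3 * C₀ / R) * ‖curl v z‖)) := by
            refine mul_le_mul hΓ ?_ (norm_nonneg _) (by positivity)
            calc ‖curlCLM ((fderiv ℝ (ballCutoff y (R / 3)) z).smulRight (curl v z))‖
                ≤ κ * ‖(fderiv ℝ (ballCutoff y (R / 3)) z).smulRight (curl v z)‖ := ContinuousLinearMap.le_opNorm _ _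
              _ = κ * (‖fderiv ℝ (ballCutoff y (R / 3)) z‖ * ‖curl v z‖) := by
                  rw [ContinuousLinearMap.norm_smulRight_apply]
              _ ≤ κ * ((3 * C₀ / R) * ‖curl v z‖) :=
                  mul_le_mul_of_nonneg_left (mul_le_mul_of_nonneg_right (hDχ z) (norm_nonneg _)) hκ0
        _ = (9 * κ * C₀ / (8 * Real.pi)) / R ^ 2 * ‖curl v z‖ := by field_simp; ring
  · have h0 : fderiv ℝ (ballCutoff y (R / 3)) z = 0 :=
      fderiv_ballCutoff_eq_zero_of_le_norm hr0 (by linarith)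
    rw [h0]; simp

/-- Shell bound (b): one IBP'd middle term, `‖∫(∂ᵢΓ)(y−z)•(∂ᵢχ v)(z)‖ ≤ (27C₀/(16π)) R⁻³ ∫_{B(y,R)}‖v‖` (`‖eᵢ‖ = 1`). -/
theorem shell_bound_middle {v : EuclideanSpace ℝ (Fin 3) → EuclideanSpace ℝ (Fin 3)} (hv : ContDiff ℝ 2 v)
    {C₀ : ℝ} (hC₀0 : 0 ≤ C₀)
    (hC₀ : ∀ (c : EuclideanSpace ℝ (Fin 3)) (r : ℝ), 0 < r → ∀ z, ‖fderiv ℝ (ballCutoff c r) z‖ ≤ C₀ / r)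
    (y : EuclideanSpace ℝ (Fin 3)) {R : ℝ} (hR : 0 < R) {a : EuclideanSpace ℝ (Fin 3)} (ha : ‖a‖ = 1) :
    ‖∫ z, (fderiv ℝ newtonKernel (y - z) a) • ((fderiv ℝ (ballCutoff y (R / 3)) z a) • v z)‖ ≤
      (27 * C₀ / (16 * Real.pi)) / R ^ 3 * ∫ z in ball y R, ‖v z‖ := by
  have hr0 : 0 < R / 3 := by positivity
  have hDχ : ∀ z, ‖fderiv ℝ (ballCutoff y (R / 3)) z a‖ ≤ 3 * C₀ / R := by
    intro z
    calc ‖fderiv ℝ (ballCutoff y (R / 3)) z a‖ ≤ ‖fderiv ℝ (ballCutoff y (R / 3)) z‖ * ‖a‖ := ContinuousLinearMap.le_opNorm _ _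
      _ ≤ C₀ / (R / 3) * 1 := by rw [ha]; exact mul_le_mul_of_nonneg_right (hC₀ y (R / 3) hr0 z) zero_le_one
      _ = 3 * C₀ / R := by field_simp
  refine norm_integral_le_of_shell hv.continuous (fun z _ => ?_) (fun z hz => ?_)
  · by_cases hin : ‖z - y‖ < 2 * R / 3
    · have h0 : fderiv ℝ (ballCutoff y (R / 3)) z = 0 :=
        fderiv_ballCutoff_eq_zero_of_mem_ball hr0 (by rw [mem_ball_iff_norm]; linarith)
      rw [h0]; simp; positivity
    · rw [not_lt] at hin
      obtain ⟨-, hDΓ⟩ := newtonKernel_shell_bounds hR hin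
      have h1 : ‖fderiv ℝ newtonKernel (y - z) a‖ ≤ 9 / (16 * Real.pi * R ^ 2) := by
        calc ‖fderiv ℝ newtonKernel (y - z) a‖ ≤ ‖fderiv ℝ newtonKernel (y - z)‖ * ‖a‖ := ContinuousLinearMap.le_opNorm _ _
          _ ≤ 9 / (16 * Real.pi * R ^ 2) := by rw [ha, mul_one]; exact hDΓ
      calc ‖(fderiv ℝ newtonKernel (y - z) a) • ((fderiv ℝ (ballCutoff y (R / 3)) z a) • v z)‖
          = ‖fderiv ℝ newtonKernel (y - z) a‖ * (‖fderiv ℝ (ballCutoff y (R / 3)) z a‖ * ‖v z‖) := by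
            rw [norm_smul, norm_smul, Real.norm_eq_abs, ← Real.norm_eq_abs]
        _ ≤ (9 / (16 * Real.pi * R ^ 2)) * ((3 * C₀ / R) * ‖v z‖) :=
            mul_le_mul h1 (mul_le_mul_of_nonneg_right (hDχ z) (norm_nonneg _)) (by positivity) (by positivity)
        _ = (27 * C₀ / (16 * Real.pi)) / R ^ 3 * ‖v z‖ := by field_simp; ring
  · have h0 : fderiv ℝ (ballCutoff y (R / 3)) z = 0 :=
      fderiv_ballCutoff_eq_zero_of_le_norm hr0 (by linarith)
    rw [h0]; simp

/-- Shell bound (c): the `(Δχ) v` term, `‖∫Γ(y−z)•((Δχ)(z) v(z))‖ ≤ (27C₂/(8π)) R⁻³ ∫_{B(y,R)}‖v‖`. -/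
theorem shell_bound_laplacian {v : EuclideanSpace ℝ (Fin 3) → EuclideanSpace ℝ (Fin 3)} (hv : ContDiff ℝ 2 v)
    {C₂ : ℝ} (hC₂0 : 0 ≤ C₂)
    (hC₂ : ∀ (c : EuclideanSpace ℝ (Fin 3)) (r : ℝ), 0 < r → ∀ z, |(Δ (ballCutoff c r)) z| ≤ C₂ / r ^ 2)
    (y : EuclideanSpace ℝ (Fin 3)) {R : ℝ} (hR : 0 < R) :
    ‖∫ z, newtonKernel (y - z) • (((Δ (ballCutoff y (R / 3))) z) • v z)‖ ≤
      (27 * C₂ / (8 * Real.pi)) / R ^ 3 * ∫ z in ball y R, ‖v z‖ := by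
  have hr0 : 0 < R / 3 := by positivity
  have hΔχ : ∀ z, |(Δ (ballCutoff y (R / 3))) z| ≤ 9 * C₂ / R ^ 2 := by
    intro z
    calc |(Δ (ballCutoff y (R / 3))) z| ≤ C₂ / (R / 3) ^ 2 := hC₂ y (R / 3) hr0 z
      _ = 9 * C₂ / R ^ 2 := by field_simp; ring
  refine norm_integral_le_of_shell hv.continuous (fun z _ => ?_) (fun z hz => ?_)
  · by_cases hin : ‖z - y‖ < 2 * R / 3
    · have h0 : (Δ (ballCutoff y (R / 3))) z = 0 :=
        laplacian_ballCutoff_eq_zero_of_mem_ball hr0 (by rw [mem_ball_iff_norm]; linarith)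
      rw [h0]; simp; positivity
    · rw [not_lt] at hin
      obtain ⟨hΓ, -⟩ := newtonKernel_shell_bounds hR hin
      calc ‖newtonKernel (y - z) • (((Δ (ballCutoff y (R / 3))) z) • v z)‖
          = ‖newtonKernel (y - z)‖ * (|(Δ (ballCutoff y (R / 3))) z| * ‖v z‖) := by
            rw [norm_smul, norm_smul, Real.norm_eq_abs (Δ (ballCutoff y (R / 3)) z)]
        _ ≤ (3 / (8 * Real.pi * R)) * ((9 * C₂ / R ^ 2) * ‖v z‖) :=
            mul_le_mul hΓ (mul_le_mul_of_nonneg_right (hΔχ z) (norm_nonneg _)) (by positivity) (by positivity)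
        _ = (27 * C₂ / (8 * Real.pi)) / R ^ 3 * ‖v z‖ := by field_simp; ring
  · have h0 : (Δ (ballCutoff y (R / 3))) z = 0 :=
      laplacian_ballCutoff_eq_zero_of_not_mem_closedBall hr0 (by rw [mem_closedBall_iff_norm, not_le]; linarith)
    rw [h0]; simp

/-- **H2♭ — `stub_shellKernelBound : ShellKernelBound` (BY NAME).** -/
theorem stub_shellKernelBound : ShellKernelBound := by
  obtain ⟨C₀, hC₀0, hC₀⟩ := exists_norm_fderiv_ballCutoff_le
  obtain ⟨C₂, hC₂0, hC₂⟩ := exists_abs_laplacian_ballCutoff_le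
  set κ : ℝ := ‖(curlCLM : ((EuclideanSpace ℝ (Fin 3)) →L[ℝ] (EuclideanSpace ℝ (Fin 3))) →L[ℝ]
    (EuclideanSpace ℝ (Fin 3)))‖ with hκ
  have hκ0 : 0 ≤ κ := by rw [hκ]; positivity
  set Kω : ℝ := 9 * κ * C₀ / (8 * Real.pi) with hKω
  set Kv : ℝ := 81 * C₀ / (8 * Real.pi) + 27 * C₂ / (8 * Real.pi) with hKv
  have hKω0 : 0 ≤ Kω := by positivity
  have hKv0 : 0 ≤ Kv := by positivity
  refine ⟨1 + Kω + Kv, by linarith, ?_⟩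
  intro v hv hdiv y R hR
  set e := stdOrthonormalBasis ℝ (EuclideanSpace ℝ (Fin 3)) with he
  set Iv : ℝ := ∫ z in ball y R, ‖v z‖ with hIv
  set Iω : ℝ := ∫ z in ball y R, ‖curl v z‖ with hIω
  have hIv0 : 0 ≤ Iv := integral_nonneg fun z => norm_nonneg _
  have hIω0 : 0 ≤ Iω := integral_nonneg fun z => norm_nonneg _
  have hA := shell_bound_cross hv hC₀0 hC₀ y hR
  have hD := shell_bound_laplacian hv hC₂0 hC₂ y hR
  have hΦ : ∀ i, ‖∫ z, (fderiv ℝ newtonKernel (y - z) (e i)) • ((fderiv ℝ (ballCutoff y (R / 3)) z (e i)) • v z)‖ ≤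
      (27 * C₀ / (16 * Real.pi)) / R ^ 3 * Iv := fun i =>
    shell_bound_middle hv hC₀0 hC₀ y hR (e.orthonormal.1 i)
  have hcard : (Finset.univ : Finset (Fin (Module.finrank ℝ (EuclideanSpace ℝ (Fin 3))))).card = 3 := by
    simp [finrank_euclideanSpace]
  have hsum : ‖∑ i, ∫ z, (fderiv ℝ newtonKernel (y - z) (e i)) • ((fderiv ℝ (ballCutoff y (R / 3)) z (e i)) • v z)‖ ≤
      3 * ((27 * C₀ / (16 * Real.pi)) / R ^ 3 * Iv) := by
    refine (norm_sum_le _ _).trans ?_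
    calc ∑ i, ‖∫ z, (fderiv ℝ newtonKernel (y - z) (e i)) • ((fderiv ℝ (ballCutoff y (R / 3)) z (e i)) • v z)‖
        ≤ ∑ _i : Fin (Module.finrank ℝ (EuclideanSpace ℝ (Fin 3))), (27 * C₀ / (16 * Real.pi)) / R ^ 3 * Iv :=
          Finset.sum_le_sum fun i _ => hΦ i
      _ = 3 * ((27 * C₀ / (16 * Real.pi)) / R ^ 3 * Iv) := by rw [Finset.sum_const, hcard, nsmul_eq_mul]; norm_num
  rw [shell_representation hv hdiv y hR]
  calc ‖(∫ z, newtonKernel (y - z) • curlCLM ((fderiv ℝ (ballCutoff y (R / 3)) z).smulRight (curl v z))) +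
        (2 : ℝ) • (∑ i, ∫ z, (fderiv ℝ newtonKernel (y - z) (e i)) • ((fderiv ℝ (ballCutoff y (R / 3)) z (e i)) • v z)) -
        ∫ z, newtonKernel (y - z) • (((Δ (ballCutoff y (R / 3))) z) • v z)‖
      ≤ ‖∫ z, newtonKernel (y - z) • curlCLM ((fderiv ℝ (ballCutoff y (R / 3)) z).smulRight (curl v z))‖ +
          ‖(2 : ℝ) • ∑ i, ∫ z, (fderiv ℝ newtonKernel (y - z) (e i)) • ((fderiv ℝ (ballCutoff y (R / 3)) z (e i)) • v z)‖ +
          ‖∫ z, newtonKernel (y - z) • (((Δ (ballCutoff y (R / 3))) z) • v z)‖ := norm_sub_le_of_le (norm_add_le _ _) le_rfl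
    _ ≤ Kω / R ^ 2 * Iω + 2 * (3 * ((27 * C₀ / (16 * Real.pi)) / R ^ 3 * Iv)) + (27 * C₂ / (8 * Real.pi)) / R ^ 3 * Iv := by
          refine add_le_add (add_le_add hA ?_) hD
          rw [norm_smul, Real.norm_eq_abs, abs_of_pos two_pos]
          exact mul_le_mul_of_nonneg_left hsum zero_le_two
    _ = Kω * ((R ^ 2)⁻¹ * Iω) + Kv * ((R ^ 3)⁻¹ * Iv) := by rw [hKv, hKω]; field_simp; ring
    _ ≤ (1 + Kω + Kv) * ((R ^ 2)⁻¹ * Iω) + (1 + Kω + Kv) * ((R ^ 3)⁻¹ * Iv) := by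
          have h1 : 0 ≤ (R ^ 2)⁻¹ * Iω := by positivity
          have h2 : 0 ≤ (R ^ 3)⁻¹ * Iv := by positivity
          nlinarith
    _ = (1 + Kω + Kv) * ((R ^ 3)⁻¹ * Iv + (R ^ 2)⁻¹ * Iω) := by ring

end Summit.NavierStokesRegularity.NavierStokesRegularity.Cruxes.TypeIQuantSubcubicExp.HelmholtzCentre

end
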